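import Literature.AnabelianGeometry.AbsoluteAnabelian.AbsTopII.TwoTripodNodalOpenness
import Literature.GroupTheory.CombinatorialGroupTheory.FoxPathChainsThree
import Literature.GroupTheory.CombinatorialGroupTheory.FreeFactorFibredTwist
import Mathlib.Topology.Algebra.ClopenNhdofOne
import Mathlib.Data.ZMod.Basic
import HarnessLib

/-!
# [AbsTopII] Prop 1.3 (v) at the two-vertex nodal datum, I: the fixed subgroup of a power of the Dehn twist IS `Π_v`

S. Mochizuki, *Topics in Absolute Anabelian Geometry II* [AbsTopII] (bib `MochizukiAbsTopII2013`; locators =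
PDF pages of the kurims manuscript `paper:url-585b8d0ad0d9`), §1, Prop 1.3 (v) p. 12 ("`D_v = C_{Π_H}(I_v) =
N_{Π_H}(I_v)`"), proof p. 13 (via the action of `Π_I` on the pro-`Σ` trees of the coverings); Lyndon–Schupp Ch. II §3
(Fox calculus) [cite: LyndonSchupp2001, Ch. II §3].

PROOF-ONLY companion of `AbsTopII/TwoTripodNodalDatum.lean` (abc-iut-f-066 gen 6, row «P13v-TWO-VERTEX»), at the DPSC
datum `M.dpsc` of the degenerating 4-pointed sphere (two tripods `v_A`, `v_B`, ONE non-loop node, `Π_H = Π_I = P` a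
pro-`Σ` completion of `Γ_{0,4} ⋊_τ ℤ`, `τ` the Dehn twist along the node `c₁c₂`; `Π_𝔾 = closure ι(inl Γ_{0,4})`,
`T = closure ι(inr ℤ) = I_{v_A}`, `U = closure ⟨ι(inl (c₁c₂)⁻¹ · inr 1)⟩ = I_{v_B}`), EVERY `Σ`.  The one residual of
Prop 1.3 (v) at this datum (abc-iut-f-066 gen 5 census) is

> **KEY₂.** `g ∈ Π_𝔾`, `n ≥ 1`, `g · t₀ⁿ = t₀ⁿ · g`  ⟹  `g ∈ Π_{v_A}` — the fixed subgroup of a non-trivial power of the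
> pro-`Σ` Dehn twist `τ̂` of `F̂₃^Σ` (`c₁ ↦ c₁`, `c₂ ↦ c₂`, `c₃ ↦ (c₁c₂) c₃ (c₁c₂)⁻¹`) is the free factor `⟨c₁, c₂⟩^`,

and its mirror for the twisted section `u₀ = ι(inl (c₁c₂)⁻¹ · inr 1)`, which fixes `c₃`, `c₀` and conjugates `c₁` by
`c₃c₀ = (c₁c₂)⁻¹`.  Both are instances of ONE statement, proved here:

* `mem_closure_of_commute_pow` — for ANY `s ∈ P` and ANY free basis `(b₀, b₁, b₂)` of `Γ_{0,4}` with
  `s ι(b₀) s⁻¹ = ι(b₀)`, `s ι(b₁) s⁻¹ = ι(b₁)`, `s ι(b₂) s⁻¹ = ι((b₀b₁) b₂ (b₀b₁)⁻¹)`: an element `g ∈ Π_𝔾` commuting with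
  some `sⁿ`, `n ≥ 1`, lies in `closure ι(inl ⟨b₀, b₁⟩)`.
  ROUTE (abc-iut-f-069's Fox-calculus shadow of Bass–Serre for the loop datum, `DehnTwistFixedSubgroup.lean` p479118,
  re-derived for a CONJUGATION twist on THREE generators and for PRO-`Σ` completions): for an open normal `V ≤ P` with
  finite quotient `G = P/V` (`φ : P → G`, a `Σ`-group), let `r` be the order of `φ(s)` and `K := r·n`; then `s^K` acts
  trivially on `G`, commutes with `g`, and conjugates `ι(b₂)` into `ι(w^K b₂ w^{-K})` (`w = b₀b₁`), so `W^K = φ(w)^K`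
  commutes with `A₂ = φ ι(b₂)`.  The continuous Fox homomorphism `ψ : Π_𝔾 → W3 G (ZMod ℓ^K)` (`ℓ ∈ Σ`, so the target is a
  finite `Σ`-group and `ψ` exists by the universal property of the pro-`Σ` completion `κG : Γ_{0,4} → Π_𝔾`;
  `(K : ZMod ℓ^K) ≠ 0` as `ℓ^K > K ≥ 1`) has `G`-component `φ`, takes values in path chains, and intertwines
  `conj(s^K)` with the chain endomorphism `thetaConj` (three pairs of continuous homomorphisms agreeing on the dense
  `κG(Γ_{0,4})`); hence `D(f₃(g)) = 0` and the division-free coset-sum test `FoxChain.mem_of_fox_chain₃` gives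
  `φ(g) ∈ φ(closure ι⟨b₀,b₁⟩)`, i.e. `g ∈ closure ι⟨b₀,b₁⟩ · V` for every `V`; compactness finishes.
* `mem_vertGpA_of_commute_pow_T` — KEY₂ at `s = t₀ = ι(inr 1)`, basis `(c₁, c₂, c₃)`: the conclusion is `ι(Π_{v_A})`;
* `mem_vertGpB_of_commute_pow_U` — KEY₂ at `s = u₀`, basis `(c₃, c₀, c₁)`: the conclusion is `ι(Π_{v_B})`.
Part II (`TwoTripodNodalProp13v.lean`) turns these into `C_P(T) = N_P(T) = Π_{v_A}·T`, `C_P(U) = N_P(U) = Π_{v_B}·U` and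
the typed `DPSCData.Prop13v` (F-0278) / `DPSCIndexData.Prop_1_3_v'` (F-0300) at `M.dpsc`, no hypothesis.
HONEST FRAMING: classical profinite group theory (pro-`Σ` completions of free groups, finite quotients, Fox calculus)
under OUR kernel check, at a constructed model (constructed ≠ geometric); consistency evidence for typed rows, not a
discharge at geometric data; nothing here bears on [IUTchIII] Cor 3.12; no side taken.
-/

noncomputable section

open scoped Pointwise

namespace Literature.AnabelianGeometry.AbsoluteAnabelian.AbsTopII.TwoTripodNodal.Model

open Literature.AnabelianGeometry.SemiGraphs
open Literature.AnabelianGeometry.SemiGraphs.SemiGraphOfAnabelioids (IsProSigmaCompletion)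
open Literature.AnabelianGeometry.SemiGraphs.SemiGraphOfAnabelioids.IsProSigmaCompletion
open Literature.AnabelianGeometry.Anabelioids (IsSigmaInteger)
open Literature.GroupTheory.CombinatorialGroupTheory
open Literature.GroupTheory.CombinatorialGroupTheory.PuncturedSurfaceGroup
open Literature.GroupTheory.CombinatorialGroupTheory.FreeFactorFibredTwist (lift_apply_basis mem_closure_range_basis)
open Literature.GroupTheory.CombinatorialGroupTheory.FoxChain
open _root_.Topology

variable {Sigma : Set ℕ} (M : Model Sigma)

/-! ### Elementary: conjugation by powers -/

/-- If `s` fixes `x` under conjugation, so does every power of `s`. [cite: MochizukiAbsTopII2013, Prop 1.3 (v) p.12] -/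
theorem pow_mul_mul_pow_inv_of_fixed {s x : M.P} (h : s * x * s⁻¹ = x) (k : ℕ) : s ^ k * x * (s ^ k)⁻¹ = x := by
  induction k with
  | zero => rw [pow_zero, inv_one, one_mul, mul_one]
  | succ k ih =>
    rw [pow_succ', mul_inv_rev, mul_assoc s (s ^ k) x, ← mul_assoc (s * (s ^ k * x)), mul_assoc s (s ^ k * x),
      ih, h]

/-- A commuting element commutes with every power (`g sⁿ = sⁿ g ⇒ g s^{kn} = s^{kn} g`). [cite: MochizukiAbsTopII2013, Prop 1.3 (v) p.12] -/
theorem commute_pow_mul {g s : M.P} {n : ℕ} (h : g * s ^ n = s ^ n * g) (k : ℕ) : g * s ^ (k * n) = s ^ (k * n) * g := by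
  have hc : Commute g (s ^ n) := h
  have := hc.pow_right k
  rw [← pow_mul, mul_comm n k] at this
  exact this

/-! ### The Fox target is a finite `Σ`-group -/

/-- `|W3 G (ZMod m)| = m^{|G|} · m^{|G|} · m^{|G|} · |G|`. [cite: LyndonSchupp2001, Ch. II §3] -/
theorem natCard_W3 (G : Type) [Group G] [Finite G] (m : ℕ) [NeZero m] :
    Nat.card (W3 G (ZMod m)) = m ^ Nat.card G * (m ^ Nat.card G * m ^ Nat.card G) * Nat.card G := by
  let eW : W3 G (ZMod m) ≃ Multiplicative (V3 G (ZMod m)) × G :=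
    { toFun := fun w => (w.left, w.right)
      invFun := fun p => ⟨p.1, p.2⟩
      left_inv := fun _ => rfl
      right_inv := fun _ => rfl }
  rw [Nat.card_congr eW, Nat.card_prod, Nat.card_congr Multiplicative.toAdd, Nat.card_prod, Nat.card_prod,
    Nat.card_fun, Nat.card_zmod]

/-- For `ℓ ∈ Σ` prime and `G` a finite group of `Σ`-integer order, every subgroup of the Fox group
`W3 G (ZMod ℓ^N)` has `Σ`-integer index. [cite: MochizukiSemiAnbd2006, Def. 2.9(i) p.31] -/
theorem isSigmaInteger_index_W3 {ℓ N : ℕ} (hℓ : ℓ.Prime) (hℓS : ℓ ∈ Sigma) (G : Type) [Group G] [Finite G]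
    (hG : IsSigmaInteger Sigma (Nat.card G)) (V : Subgroup (W3 G (ZMod (ℓ ^ N)))) : IsSigmaInteger Sigma V.index := by
  haveI : NeZero (ℓ ^ N) := ⟨(pow_pos hℓ.pos N).ne'⟩
  haveI : Finite (W3 G (ZMod (ℓ ^ N))) :=
    Finite.of_injective (fun w : W3 G (ZMod (ℓ ^ N)) => (w.left, w.right))
      (fun w w' h => SemidirectProduct.ext (congrArg Prod.fst h) (congrArg Prod.snd h))
  refine IsSigmaInteger.of_dvd ?_ V.index_dvd_card
  rw [natCard_W3, ← pow_mul]
  exact (((isSigmaInteger_prime_pow hℓ hℓS _).mul ((isSigmaInteger_prime_pow hℓ hℓS _).mul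
    (isSigmaInteger_prime_pow hℓ hℓS _)))).mul hG

/-! ### Generation and density in `Π_𝔾` -/

/-- `κG(Γ_{0,4})` lies in every subgroup of `Π_𝔾` containing the images of a free basis. [cite: MochizukiSemiAnbd2006, Ex. 2.10 p.31] -/
theorem range_κG_le_of_basis_mem (b : FreeGroupBasis (Fin 3) (PuncturedSurfaceGroup 0 4)) (D : Subgroup ↥M.PiG)
    (hD : ∀ j, M.κG (b j) ∈ D) : M.κG.range ≤ D := by
  rintro _ ⟨γ, rfl⟩
  have hγ := mem_closure_range_basis b γ
  have hle : Subgroup.closure (Set.range (b : Fin 3 → PuncturedSurfaceGroup 0 4)) ≤ D.comap M.κG := by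
    rw [Subgroup.closure_le]
    rintro _ ⟨j, rfl⟩
    exact hD j
  exact hle hγ

/-- A CLOSED subgroup of `Π_𝔾` containing the images of a free basis of `Γ_{0,4}` is all of `Π_𝔾` (`κG` has dense
image). [cite: RibesZalesskii2010, Lemma 3.2.1] -/
theorem subgroup_eq_top_of_isClosed_of_basis_mem (b : FreeGroupBasis (Fin 3) (PuncturedSurfaceGroup 0 4))
    (D : Subgroup ↥M.PiG) (hDc : IsClosed (D : Set ↥M.PiG)) (hD : ∀ j, M.κG (b j) ∈ D) : D = ⊤ := by
  rw [eq_top_iff]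
  intro y _
  have hsub : (Set.univ : Set ↥M.PiG) ⊆ D := by
    rw [← M.isProSigmaCompletion_κG.dense.closure_eq]
    refine closure_minimal ?_ hDc
    rintro _ ⟨γ, rfl⟩
    exact M.range_κG_le_of_basis_mem b D hD ⟨γ, rfl⟩
  exact hsub (Set.mem_univ y)

/-! ### KEY₂, finite quotient by finite quotient -/

section Key

variable (b : FreeGroupBasis (Fin 3) (PuncturedSurfaceGroup 0 4)) {s : M.P}

/-- The endomorphism `θ` of `Γ_{0,4}` induced by the twist on a basis: `b₀ ↦ b₀`, `b₁ ↦ b₁`, `b₂ ↦ u b₂ u⁻¹`; conjugation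
by `s` on `ι(inl Γ_{0,4})` IS `ι ∘ inl ∘ θ` as soon as it is on the basis. [cite: MochizukiAbsTopII2013, Def 1.2 (ii) p.10] -/
theorem conj_eq_of_basis (u : PuncturedSurfaceGroup 0 4)
    (hs0 : s * M.ι (SemidirectProduct.inl (b 0)) * s⁻¹ = M.ι (SemidirectProduct.inl (b 0)))
    (hs1 : s * M.ι (SemidirectProduct.inl (b 1)) * s⁻¹ = M.ι (SemidirectProduct.inl (b 1)))
    (hs2 : s * M.ι (SemidirectProduct.inl (b 2)) * s⁻¹ = M.ι (SemidirectProduct.inl (u * b 2 * u⁻¹)))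
    (γ : PuncturedSurfaceGroup 0 4) :
    s * M.ι (SemidirectProduct.inl γ) * s⁻¹ = M.ι (SemidirectProduct.inl (b.lift ![b 0, b 1, u * b 2 * u⁻¹] γ)) := by
  have h : ((MulAut.conj s).toMonoidHom.comp (M.ι.comp SemidirectProduct.inl)) =
      (M.ι.comp SemidirectProduct.inl).comp (b.lift ![b 0, b 1, u * b 2 * u⁻¹]) := by
    refine b.ext_hom _ _ fun j => ?_
    simp only [MonoidHom.comp_apply, MulEquiv.coe_toMonoidHom, MulAut.conj_apply, lift_apply_basis]
    fin_cases j
    · exact hs0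
    · exact hs1
    · exact hs2
  have := DFunLike.congr_fun h γ
  simpa only [MonoidHom.comp_apply, MulEquiv.coe_toMonoidHom, MulAut.conj_apply] using this

/-- **Powers of the twist on the conjugated generator**: `s^k ι(b₂) s^{-k} = ι(w^k b₂ w^{-k})` with `w = b₀b₁`.
[cite: MochizukiAbsTopII2013, Def 1.2 (ii) p.10] -/
theorem pow_conj_b2
    (hs0 : s * M.ι (SemidirectProduct.inl (b 0)) * s⁻¹ = M.ι (SemidirectProduct.inl (b 0)))
    (hs1 : s * M.ι (SemidirectProduct.inl (b 1)) * s⁻¹ = M.ι (SemidirectProduct.inl (b 1)))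
    (hs2 : s * M.ι (SemidirectProduct.inl (b 2)) * s⁻¹ =
      M.ι (SemidirectProduct.inl (b 0 * b 1 * b 2 * (b 0 * b 1)⁻¹))) (k : ℕ) :
    s ^ k * M.ι (SemidirectProduct.inl (b 2)) * (s ^ k)⁻¹ =
      M.ι (SemidirectProduct.inl ((b 0 * b 1) ^ k * b 2 * ((b 0 * b 1) ^ k)⁻¹)) := by
  induction k with
  | zero => rw [pow_zero, pow_zero, inv_one, one_mul, mul_one, inv_one, one_mul, mul_one]
  | succ k ih =>
    have hθ := M.conj_eq_of_basis b (b 0 * b 1) hs0 hs1 hs2 ((b 0 * b 1) ^ k * b 2 * ((b 0 * b 1) ^ k)⁻¹)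
    rw [pow_succ', mul_inv_rev, mul_assoc s (s ^ k), ← mul_assoc (s * (s ^ k * _)), mul_assoc s (s ^ k * _), ih, hθ]
    congr 2
    simp only [map_mul, map_inv, map_pow, lift_apply_basis, Matrix.cons_val_zero, Matrix.cons_val_one,
      Matrix.head_cons, Matrix.cons_val_two, Matrix.tail_cons]
    set w : PuncturedSurfaceGroup 0 4 := b 0 * b 1
    rw [pow_succ]
    group

/-- **KEY₂, finite-quotient form.**  Under the three basis hypotheses on `s`, if `g ∈ Π_𝔾` commutes with `sⁿ`
(`n ≥ 1`), then for every open normal subgroup `V` of `P` there is `p ∈ closure ι(inl ⟨b₀, b₁⟩)` with `p⁻¹ g ∈ V`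
(continuous Fox homomorphism into `W3 (P/V) (ZMod ℓ^K)` and the division-free coset-sum test; see the module
docstring). [cite: MochizukiAbsTopII2013, Prop 1.3 (v) p.12] -/
theorem exists_mem_closure_inv_mul_mem (hne : Sigma.Nonempty) (hprime : ∀ p ∈ Sigma, p.Prime)
    (hs0 : s * M.ι (SemidirectProduct.inl (b 0)) * s⁻¹ = M.ι (SemidirectProduct.inl (b 0)))
    (hs1 : s * M.ι (SemidirectProduct.inl (b 1)) * s⁻¹ = M.ι (SemidirectProduct.inl (b 1)))
    (hs2 : s * M.ι (SemidirectProduct.inl (b 2)) * s⁻¹ =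
      M.ι (SemidirectProduct.inl (b 0 * b 1 * b 2 * (b 0 * b 1)⁻¹)))
    {g : M.P} (hg : g ∈ M.PiG) {n : ℕ} (hn : 0 < n) (hcomm : g * s ^ n = s ^ n * g)
    (V : OpenNormalSubgroup M.P) :
    ∃ p ∈ ((Subgroup.closure ({b 0, b 1} : Set (PuncturedSurfaceGroup 0 4))).map
        (M.ι.comp SemidirectProduct.inl)).topologicalClosure, p⁻¹ * g ∈ V := by
  classical
  haveI hN : M.PiG.Normal := M.normal_PiG
  haveI : CompactSpace ↥M.PiG := isCompact_iff_compactSpace.mp M.isClosed_PiG.isCompact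
  -- the finite quotient `G = P / V`, a `Σ`-group
  letI : Fintype (M.P ⧸ V.toSubgroup) := Fintype.ofFinite _
  set π : M.P →* M.P ⧸ V.toSubgroup := QuotientGroup.mk' V.toSubgroup with hπ
  have hGsig : IsSigmaInteger Sigma (Nat.card (M.P ⧸ V.toSubgroup)) :=
    M.isProSigmaCompletion.index_open V.toSubgroup V.isNormal' V.isOpen'
  set w : PuncturedSurfaceGroup 0 4 := b 0 * b 1 with hw
  set A₀ := π (M.ι (SemidirectProduct.inl (b 0))) with hA₀
  set A₁ := π (M.ι (SemidirectProduct.inl (b 1))) with hA₁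
  set A₂ := π (M.ι (SemidirectProduct.inl (b 2))) with hA₂
  -- the exponent `K = r n`: `s^K` is trivial in `G` and commutes with `g`
  set r : ℕ := orderOf (π s) with hr_def
  have hr : 0 < r := orderOf_pos _
  set K : ℕ := r * n with hK_def
  have hKpos : 0 < K := Nat.mul_pos hr hn
  have hπK : π (s ^ K) = 1 := by rw [map_pow, hK_def, pow_mul, hr_def, pow_orderOf_eq_one, one_pow]
  have hgK : g * s ^ K = s ^ K * g := M.commute_pow_mul hcomm r
  have hconjK := M.pow_conj_b2 b hs0 hs1 hs2 K
  -- `W^K` commutes with `A₂` in `G`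
  have hπK' : π s ^ K = 1 := by rw [← map_pow]; exact hπK
  have hcommG : (A₀ * A₁) ^ K * A₂ = A₂ * (A₀ * A₁) ^ K := by
    have h := congrArg π hconjK
    simp only [map_mul, map_inv, map_pow, hπK', inv_one, one_mul, mul_one] at h
    -- h : A₂ = (A₀*A₁)^K * A₂ * ((A₀*A₁)^K)⁻¹
    rw [eq_mul_inv_iff_mul_eq] at h
    exact h.symm
  -- the coefficient ring `ZMod ℓ^K`, `ℓ ∈ Σ`, in which `K ≠ 0`
  obtain ⟨ℓ, hℓS⟩ := hne
  have hℓ : ℓ.Prime := hprime ℓ hℓS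
  haveI : NeZero (ℓ ^ K) := ⟨(pow_pos hℓ.pos K).ne'⟩
  have hKne : (K : ZMod (ℓ ^ K)) ≠ 0 := by
    rw [Ne, ZMod.natCast_eq_zero_iff]
    exact Nat.not_dvd_of_pos_of_lt hKpos (K.lt_pow_self hℓ.one_lt)
  -- the Fox group over `G` (finite, discrete, a `Σ`-group) and the continuous Fox homomorphism `ψ`
  letI : TopologicalSpace (W3 (M.P ⧸ V.toSubgroup) (ZMod (ℓ ^ K))) := ⊥
  haveI : DiscreteTopology (W3 (M.P ⧸ V.toSubgroup) (ZMod (ℓ ^ K))) := ⟨rfl⟩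
  haveI : Finite (W3 (M.P ⧸ V.toSubgroup) (ZMod (ℓ ^ K))) :=
    Finite.of_injective (fun w : W3 (M.P ⧸ V.toSubgroup) (ZMod (ℓ ^ K)) => (w.left, w.right))
      (fun w w' h => SemidirectProduct.ext (congrArg Prod.fst h) (congrArg Prod.snd h))
  let ψ₀ : PuncturedSurfaceGroup 0 4 →* W3 (M.P ⧸ V.toSubgroup) (ZMod (ℓ ^ K)) := b.lift ![w1 A₀, w2 A₁, w3 A₂]
  have hψ₀b : ∀ j, ψ₀ (b j) = ![w1 A₀, w2 A₁, w3 A₂] j := fun j => lift_apply_basis b _ j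
  obtain ⟨ψ, hψc, hψ⟩ := exists_continuous_extend_profinite M.isProSigmaCompletion_κG
    (fun V' _ _ => isSigmaInteger_index_W3 hℓ hℓS (M.P ⧸ V.toSubgroup) hGsig V') ψ₀
  have hψb0 : ψ (M.κG (b 0)) = w1 A₀ := by rw [hψ, hψ₀b]; rfl
  have hψb1 : ψ (M.κG (b 1)) = w2 A₁ := by rw [hψ, hψ₀b]; rfl
  have hψb2 : ψ (M.κG (b 2)) = w3 A₂ := by rw [hψ, hψ₀b]; rfl
  have hrc : Continuous (SemidirectProduct.rightHom :
      W3 (M.P ⧸ V.toSubgroup) (ZMod (ℓ ^ K)) → M.P ⧸ V.toSubgroup) := continuous_of_discreteTopology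
  have hΘc : Continuous (thetaConj A₀ A₁ A₂ K :
      W3 (M.P ⧸ V.toSubgroup) (ZMod (ℓ ^ K)) → W3 (M.P ⧸ V.toSubgroup) (ZMod (ℓ ^ K))) :=
    continuous_of_discreteTopology
  -- (i) the `G`-component of `ψ` is `φ = π|_{Π_𝔾}`
  have hright : ∀ x : ↥M.PiG, (ψ x).right = π (x : M.P) := by
    have h := continuous_extend_profinite_unique M.isProSigmaCompletion_κG
      (F := (SemidirectProduct.rightHom (N := Multiplicative (V3 (M.P ⧸ V.toSubgroup) (ZMod (ℓ ^ K))))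
        (G := M.P ⧸ V.toSubgroup) (φ := foxAct3)).comp ψ)
      (F' := π.comp M.PiG.subtype) (hrc.comp hψc)
      (QuotientGroup.continuous_mk.comp continuous_subtype_val) fun γ => by
        have hγ : (π.comp M.PiG.subtype) (M.κG γ) = π (M.ι (SemidirectProduct.inl γ)) := rfl
        rw [hγ, MonoidHom.comp_apply, hψ]
        have hb : (SemidirectProduct.rightHom.comp ψ₀) = π.comp (M.ι.comp SemidirectProduct.inl) := by
          refine b.ext_hom _ _ fun j => ?_
          rw [MonoidHom.comp_apply, hψ₀b]
          fin_cases j <;> rfl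
        exact DFunLike.congr_fun hb γ
    intro x
    exact DFunLike.congr_fun h x
  -- (ii) every `ψ x` is a path chain
  have hpath : ∀ x : ↥M.PiG, ψ x ∈ pathSub3 A₀ A₁ A₂ := by
    let D : Subgroup ↥M.PiG := (pathSub3 A₀ A₁ A₂).comap ψ
    have hDc : IsClosed (D : Set ↥M.PiG) := by
      change IsClosed (ψ ⁻¹' ((pathSub3 A₀ A₁ A₂ : Subgroup (W3 (M.P ⧸ V.toSubgroup) (ZMod (ℓ ^ K)))) : Set _))
      exact (isClosed_discrete _).preimage hψc
    have hD : ∀ j, M.κG (b j) ∈ D := by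
      intro j
      show ψ (M.κG (b j)) ∈ pathSub3 A₀ A₁ A₂
      fin_cases j
      · exact hψb0 ▸ w1_mem_pathSub3 A₀ A₁ A₂
      · exact hψb1 ▸ w2_mem_pathSub3 A₀ A₁ A₂
      · exact hψb2 ▸ w3_mem_pathSub3 A₀ A₁ A₂
    have hDtop := M.subgroup_eq_top_of_isClosed_of_basis_mem b D hDc hD
    intro x
    have hx : x ∈ D := hDtop ▸ Subgroup.mem_top x
    exact hx
  -- (iii) `ψ ∘ conj(s^K) = Θ ∘ ψ` on `Π_𝔾`
  set σ : ↥M.PiG →* ↥M.PiG := (MulAut.conjNormal (s ^ K) : MulAut ↥M.PiG).toMonoidHom with hσ_def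
  have hσv : ∀ x : ↥M.PiG, ((σ x : ↥M.PiG) : M.P) = s ^ K * x * (s ^ K)⁻¹ := fun x => MulAut.conjNormal_apply _ _
  have hσc : Continuous σ := by
    refine continuous_induced_rng.mpr ?_
    have : (Subtype.val ∘ σ : ↥M.PiG → M.P) = fun x : ↥M.PiG => s ^ K * (x : M.P) * (s ^ K)⁻¹ := funext hσv
    rw [this]
    exact (continuous_const.mul continuous_subtype_val).mul continuous_const
  let θK : PuncturedSurfaceGroup 0 4 →* PuncturedSurfaceGroup 0 4 := b.lift ![b 0, b 1, w ^ K * b 2 * (w ^ K)⁻¹]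
  have hθKb : ∀ j, θK (b j) = ![b 0, b 1, w ^ K * b 2 * (w ^ K)⁻¹] j := fun j => lift_apply_basis b _ j
  have hσκ : ∀ γ, σ (M.κG γ) = M.κG (θK γ) := by
    have h : σ.comp M.κG = M.κG.comp θK := by
      refine b.ext_hom _ _ fun j => ?_
      apply Subtype.ext
      rw [MonoidHom.comp_apply, MonoidHom.comp_apply, hσv, coe_κG, coe_κG, hθKb]
      fin_cases j
      · exact M.pow_mul_mul_pow_inv_of_fixed hs0 K
      · exact M.pow_mul_mul_pow_inv_of_fixed hs1 K
      · exact hconjK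
    exact fun γ => DFunLike.congr_fun h γ
  have hΘ : ∀ x : ↥M.PiG, ψ (σ x) = thetaConj A₀ A₁ A₂ K (ψ x) := by
    have h := continuous_extend_profinite_unique M.isProSigmaCompletion_κG (F := ψ.comp σ)
      (F' := (thetaConj A₀ A₁ A₂ K).comp ψ) (hψc.comp hσc) (hΘc.comp hψc) fun γ => by
        rw [MonoidHom.comp_apply, MonoidHom.comp_apply, hσκ, hψ, hψ]
        have hb : ψ₀.comp θK = (thetaConj A₀ A₁ A₂ K).comp ψ₀ := by
          refine b.ext_hom _ _ fun j => ?_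
          rw [MonoidHom.comp_apply, MonoidHom.comp_apply, hθKb, hψ₀b]
          fin_cases j
          · show ψ₀ (b 0) = thetaConj A₀ A₁ A₂ K (w1 A₀)
            rw [hψ₀b, thetaConj_w1]; rfl
          · show ψ₀ (b 1) = thetaConj A₀ A₁ A₂ K (w2 A₁)
            rw [hψ₀b, thetaConj_w2]; rfl
          · show ψ₀ (w ^ K * b 2 * (w ^ K)⁻¹) = thetaConj A₀ A₁ A₂ K (w3 A₂)
            rw [thetaConj_w3 A₀ A₁ A₂ K hcommG, map_mul, map_mul, map_inv, map_pow, hw, map_mul, hψ₀b, hψ₀b, hψ₀b]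
            rfl
        exact DFunLike.congr_fun hb γ
    exact fun x => DFunLike.congr_fun h x
  -- (iv) `g` is fixed by `conj(s^K)`, so its chain is `Θ`-fixed and `D(f₃) = 0`
  set x : ↥M.PiG := ⟨g, hg⟩ with hx_def
  have hσx : σ x = x := by
    apply Subtype.ext
    rw [hσv]
    change s ^ K * g * (s ^ K)⁻¹ = g
    rw [← hgK, mul_inv_cancel_right]
  have hfixW : thetaConj A₀ A₁ A₂ K (ψ x) = ψ x := by rw [← hΘ, hσx]
  have hD := dConj_eq_zero_of_thetaConj_eq A₀ A₁ A₂ K (ψ x) hfixW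
  rw [dConj_def] at hD
  have hE : rt A₀ (Multiplicative.toAdd (ψ x).left).1 - (Multiplicative.toAdd (ψ x).left).1 +
      (rt A₁ (Multiplicative.toAdd (ψ x).left).2.1 - (Multiplicative.toAdd (ψ x).left).2.1) +
      (rt A₂ (Multiplicative.toAdd (ψ x).left).2.2 - (Multiplicative.toAdd (ψ x).left).2.2) = e (π g) - e 1 := by
    have h := hpath x
    rw [mem_pathSub3_iff, hright x] at h
    exact h
  -- the coset-sum test in `G` with `H = φ(closure ι⟨b₀, b₁⟩)`
  set Acl : Subgroup M.P := ((Subgroup.closure ({b 0, b 1} : Set (PuncturedSurfaceGroup 0 4))).map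
    (M.ι.comp SemidirectProduct.inl)).topologicalClosure with hAcl
  let Hq : Subgroup (M.P ⧸ V.toSubgroup) := Acl.map π
  have hmemA : ∀ d ∈ ({b 0, b 1} : Set (PuncturedSurfaceGroup 0 4)), M.ι (SemidirectProduct.inl d) ∈ Acl :=
    fun d hd => Subgroup.le_topologicalClosure _ ⟨d, Subgroup.subset_closure hd, rfl⟩
  have hA₀H : A₀ ∈ Hq := Subgroup.mem_map_of_mem π (hmemA _ (Or.inl rfl))
  have hA₁H : A₁ ∈ Hq := Subgroup.mem_map_of_mem π (hmemA _ (Or.inr rfl))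
  have hX : π g ∈ Hq := mem_of_fox_chain₃ Hq hA₀H hA₁H hKne hE hD
  obtain ⟨p, hp, hpx⟩ := Subgroup.mem_map.mp hX
  exact ⟨p, hp, QuotientGroup.eq.mp hpx⟩

/-- **KEY₂ — the elements of `Π_𝔾` commuting with a non-trivial power of the twist lie in the fixed free factor.**
For ANY `s ∈ P` acting on a free basis `(b₀, b₁, b₂)` of `Γ_{0,4}` by `b₀ ↦ b₀`, `b₁ ↦ b₁`, `b₂ ↦ (b₀b₁) b₂ (b₀b₁)⁻¹`:
`g ∈ Π_𝔾`, `n ≥ 1`, `g sⁿ = sⁿ g` ⟹ `g ∈ closure ι(inl ⟨b₀, b₁⟩)` (finite-quotient form + `⋂_V A·V = A` for the compact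
`A`). [cite: MochizukiAbsTopII2013, Prop 1.3 (v) p.12] -/
theorem mem_closure_of_commute_pow (hne : Sigma.Nonempty) (hprime : ∀ p ∈ Sigma, p.Prime)
    (hs0 : s * M.ι (SemidirectProduct.inl (b 0)) * s⁻¹ = M.ι (SemidirectProduct.inl (b 0)))
    (hs1 : s * M.ι (SemidirectProduct.inl (b 1)) * s⁻¹ = M.ι (SemidirectProduct.inl (b 1)))
    (hs2 : s * M.ι (SemidirectProduct.inl (b 2)) * s⁻¹ =
      M.ι (SemidirectProduct.inl (b 0 * b 1 * b 2 * (b 0 * b 1)⁻¹)))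
    {g : M.P} (hg : g ∈ M.PiG) {n : ℕ} (hn : 0 < n) (hcomm : g * s ^ n = s ^ n * g) :
    g ∈ ((Subgroup.closure ({b 0, b 1} : Set (PuncturedSurfaceGroup 0 4))).map
        (M.ι.comp SemidirectProduct.inl)).topologicalClosure := by
  set Acl : Subgroup M.P := ((Subgroup.closure ({b 0, b 1} : Set (PuncturedSurfaceGroup 0 4))).map
    (M.ι.comp SemidirectProduct.inl)).topologicalClosure with hAcl
  by_contra hx
  set S : Set M.P := (fun p : M.P => p⁻¹ * g) '' (Acl : Set M.P) with hS_def
  have hcl : IsClosed (Acl : Set M.P) := Subgroup.isClosed_topologicalClosure _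
  have hS : IsCompact S := hcl.isCompact.image (continuous_inv.mul continuous_const)
  have h1S : (1 : M.P) ∈ Sᶜ := by
    rintro ⟨p, hp, hpx⟩
    apply hx
    have h : p = g := inv_mul_eq_one.mp hpx
    rw [← h]
    exact hp
  obtain ⟨V, hV⟩ := ProfiniteGrp.exist_openNormalSubgroup_sub_open_nhds_of_one hS.isClosed.isOpen_compl h1S
  obtain ⟨p, hp, hpV⟩ := M.exists_mem_closure_inv_mul_mem b hne hprime hs0 hs1 hs2 hg hn hcomm V
  exact hV hpV ⟨p, hp, rfl⟩

end Key

/-! ### KEY₂ at the two sections: `Fix(t₀ⁿ) ∩ Π_𝔾 ⊆ Π_{v_A}`, `Fix(u₀ⁿ) ∩ Π_𝔾 ⊆ Π_{v_B}` -/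

/-- `⟨c₁, c₂⟩ = ⟨c₁, c₁c₂⟩` in `Γ_{0,4}`. [cite: MochizukiAbsTopII2013, Ex 1.1 (ii) p.9] -/
theorem closure_c_one_c_two :
    Subgroup.closure ({c 1, c 2} : Set (PuncturedSurfaceGroup 0 4)) = Subgroup.closure {c 1, c 1 * c 2} := by
  apply le_antisymm
  · rw [Subgroup.closure_le]
    rintro _ (rfl | rfl)
    · exact c_one_mem_closureA
    · exact c_two_mem_closureA
  · rw [Subgroup.closure_le]
    rintro _ (rfl | rfl)
    · exact Subgroup.subset_closure (Or.inl rfl)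
    · exact Subgroup.mul_mem _ (Subgroup.subset_closure (Or.inl rfl)) (Subgroup.subset_closure (Or.inr rfl))

/-- `⟨c₃, c₀⟩ = ⟨c₁c₂, c₃⟩` in `Γ_{0,4}` (`c₀ = (c₁c₂c₃)⁻¹`). [cite: MochizukiAbsTopII2013, Ex 1.1 (ii) p.9] -/
theorem closure_c_three_c_zero :
    Subgroup.closure ({c 3, c 0} : Set (PuncturedSurfaceGroup 0 4)) = Subgroup.closure {c 1 * c 2, c 3} := by
  apply le_antisymm
  · rw [Subgroup.closure_le]
    rintro _ (rfl | rfl)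
    · exact c_three_mem_closureB
    · exact c_zero_mem_closureB
  · rw [Subgroup.closure_le]
    rintro _ (rfl | rfl)
    · have h : (c 1 * c 2 : PuncturedSurfaceGroup 0 4) = ((c 3) * (c 0))⁻¹ := by
        rw [c_zero_eq_inv]; group
      rw [h]
      exact Subgroup.inv_mem _ (Subgroup.mul_mem _ (Subgroup.subset_closure (Or.inl rfl))
        (Subgroup.subset_closure (Or.inr rfl)))
    · exact Subgroup.subset_closure (Or.inl rfl)

/-- The twist generator `t₀ = ι(inr 1)` conjugates `ι(inl d)` to `ι(inl φ(1) d)`. [cite: MochizukiAbsTopII2013, Def 1.2 (ii) p.10] -/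
theorem t0_conj (d : PuncturedSurfaceGroup 0 4) :
    M.ι (SemidirectProduct.inr (Multiplicative.ofAdd (1 : ℤ))) * M.ι (SemidirectProduct.inl d) *
        (M.ι (SemidirectProduct.inr (Multiplicative.ofAdd (1 : ℤ))))⁻¹ =
      M.ι (SemidirectProduct.inl (M.φ (Multiplicative.ofAdd (1 : ℤ)) d)) := by
  rw [← map_inv, ← map_mul, ← map_mul,
    ← map_inv (SemidirectProduct.inr : Multiplicative ℤ →* PuncturedSurfaceGroup 0 4 ⋊[M.φ] Multiplicative ℤ),
    ← SemidirectProduct.inl_aut]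

/-- The twisted generator `u₀ = ι(inl (c₁c₂)⁻¹ · inr 1)` conjugates `ι(inl d)` to `ι(inl ((c₁c₂)⁻¹ φ(1)(d) (c₁c₂)))`.
[cite: MochizukiAbsTopII2013, Def 1.2 (ii) p.10] -/
theorem u0_conj (d : PuncturedSurfaceGroup 0 4) :
    M.ι (SemidirectProduct.inl (c 1 * c 2 : PuncturedSurfaceGroup 0 4)⁻¹ *
          SemidirectProduct.inr (Multiplicative.ofAdd (1 : ℤ))) * M.ι (SemidirectProduct.inl d) *
        (M.ι (SemidirectProduct.inl (c 1 * c 2 : PuncturedSurfaceGroup 0 4)⁻¹ *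
          SemidirectProduct.inr (Multiplicative.ofAdd (1 : ℤ))))⁻¹ =
      M.ι (SemidirectProduct.inl ((c 1 * c 2)⁻¹ * M.φ (Multiplicative.ofAdd (1 : ℤ)) d * (c 1 * c 2))) := by
  rw [← map_inv, ← map_mul, ← map_mul]
  congr 1
  have h1 : SemidirectProduct.inl (c 1 * c 2 : PuncturedSurfaceGroup 0 4)⁻¹ *
        SemidirectProduct.inr (Multiplicative.ofAdd (1 : ℤ)) * SemidirectProduct.inl d *
        (SemidirectProduct.inl (c 1 * c 2 : PuncturedSurfaceGroup 0 4)⁻¹ *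
          SemidirectProduct.inr (Multiplicative.ofAdd (1 : ℤ)))⁻¹ =
      SemidirectProduct.inl (c 1 * c 2 : PuncturedSurfaceGroup 0 4)⁻¹ *
        ((SemidirectProduct.inr (Multiplicative.ofAdd (1 : ℤ)) : PuncturedSurfaceGroup 0 4 ⋊[M.φ] Multiplicative ℤ) *
          SemidirectProduct.inl d * SemidirectProduct.inr (Multiplicative.ofAdd (1 : ℤ))⁻¹) *
        (SemidirectProduct.inl (c 1 * c 2 : PuncturedSurfaceGroup 0 4)⁻¹)⁻¹ := by
    rw [map_inv SemidirectProduct.inr]; group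
  rw [h1, ← SemidirectProduct.inl_aut, ← map_inv SemidirectProduct.inl, ← map_mul, ← map_mul, inv_inv]

/-- **KEY₂ at `v_A`: an element of `Π_𝔾` commuting with `t₀ⁿ` (`n ≥ 1`, `t₀ = ι(inr 1)` the topological generator of
`T = I_{v_A}`) lies in `ι(Π_{v_A})`** — the fixed subgroup of a non-trivial power of the pro-`Σ` Dehn twist of the
4-pointed sphere along `c₁c₂` is `⟨c₁, c₂⟩^`. [cite: MochizukiAbsTopII2013, Prop 1.3 (v) p.12] -/
theorem mem_vertGpA_of_commute_pow_T (hne : Sigma.Nonempty) (hprime : ∀ p ∈ Sigma, p.Prime) {g : M.P} (hg : g ∈ M.PiG)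
    {n : ℕ} (hn : 0 < n)
    (hcomm : g * M.ι (SemidirectProduct.inr (Multiplicative.ofAdd (1 : ℤ))) ^ n =
      M.ι (SemidirectProduct.inr (Multiplicative.ofAdd (1 : ℤ))) ^ n * g) :
    g ∈ (M.vertGpA).map M.PiG.subtype := by
  obtain ⟨b, hb⟩ := exists_freeGroupBasis_succ
  have hb0 : b 0 = c 1 := hb 0
  have hb1 : b 1 = c 2 := hb 1
  have hb2 : b 2 = c 3 := hb 2
  have h := M.mem_closure_of_commute_pow b hne hprime (s := M.ι (SemidirectProduct.inr (Multiplicative.ofAdd (1 : ℤ))))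
    (by rw [t0_conj, hb0, M.twist_c_one]) (by rw [t0_conj, hb1, M.twist_c_two])
    (by rw [t0_conj, hb2, hb0, hb1, M.twist_c_three]) hg hn hcomm
  rw [hb0, hb1, closure_c_one_c_two] at h
  rw [vertGpA_map_eq]
  exact h

/-- **KEY₂ at `v_B`: an element of `Π_𝔾` commuting with `u₀ⁿ` (`n ≥ 1`, `u₀ = ι(inl (c₁c₂)⁻¹ · inr 1)` the topological
generator of `U = I_{v_B}`) lies in `ι(Π_{v_B})`** — `u₀` fixes `c₃`, `c₀` and conjugates `c₁` by `c₃c₀ = (c₁c₂)⁻¹`: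
the same statement in the free basis `(c₃, c₀, c₁)`. [cite: MochizukiAbsTopII2013, Prop 1.3 (v) p.12] -/
theorem mem_vertGpB_of_commute_pow_U (hne : Sigma.Nonempty) (hprime : ∀ p ∈ Sigma, p.Prime) {g : M.P} (hg : g ∈ M.PiG)
    {n : ℕ} (hn : 0 < n)
    (hcomm : g * M.ι (SemidirectProduct.inl (c 1 * c 2 : PuncturedSurfaceGroup 0 4)⁻¹ *
        SemidirectProduct.inr (Multiplicative.ofAdd (1 : ℤ))) ^ n =
      M.ι (SemidirectProduct.inl (c 1 * c 2 : PuncturedSurfaceGroup 0 4)⁻¹ *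
        SemidirectProduct.inr (Multiplicative.ofAdd (1 : ℤ))) ^ n * g) :
    g ∈ (M.vertGpB).map M.PiG.subtype := by
  -- the free basis `(c₃, c₀, c₁)` of `Γ_{0,4}`
  obtain ⟨b₀, hb₀⟩ := exists_freeGroupBasis_succ
  obtain ⟨b, hb⟩ := exists_freeGroupBasis_of_lifts b₀ ![b₀ 2, (b₀ 0 * b₀ 1 * b₀ 2)⁻¹, b₀ 0]
    ![b₀ 2, (b₀ 2)⁻¹ * (b₀ 1)⁻¹ * (b₀ 0)⁻¹, b₀ 0]
    (fun i => by fin_cases i <;> simp [mul_assoc])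
    (fun i => by fin_cases i <;> simp [mul_assoc])
  have hb0 : b 0 = c 3 := by rw [hb]; simp [hb₀]
  have hb1 : b 1 = c 0 := by
    rw [hb, c_zero_eq_inv]; simp [hb₀]
  have hb2 : b 2 = c 1 := by rw [hb]; simp [hb₀]
  have hw : (c 3 * c 0 : PuncturedSurfaceGroup 0 4) = (c 1 * c 2)⁻¹ := by rw [c_zero_eq_inv]; group
  have hs0 : M.ι (SemidirectProduct.inl (c 1 * c 2 : PuncturedSurfaceGroup 0 4)⁻¹ *
        SemidirectProduct.inr (Multiplicative.ofAdd (1 : ℤ))) * M.ι (SemidirectProduct.inl (b 0)) *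
        (M.ι (SemidirectProduct.inl (c 1 * c 2 : PuncturedSurfaceGroup 0 4)⁻¹ *
          SemidirectProduct.inr (Multiplicative.ofAdd (1 : ℤ))))⁻¹ = M.ι (SemidirectProduct.inl (b 0)) := by
    rw [hb0, u0_conj, M.twist_c_three]
    congr 2
    group
  have hs1 : M.ι (SemidirectProduct.inl (c 1 * c 2 : PuncturedSurfaceGroup 0 4)⁻¹ *
        SemidirectProduct.inr (Multiplicative.ofAdd (1 : ℤ))) * M.ι (SemidirectProduct.inl (b 1)) *
        (M.ι (SemidirectProduct.inl (c 1 * c 2 : PuncturedSurfaceGroup 0 4)⁻¹ *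
          SemidirectProduct.inr (Multiplicative.ofAdd (1 : ℤ))))⁻¹ = M.ι (SemidirectProduct.inl (b 1)) := by
    rw [hb1, u0_conj, M.twist_c_zero]
    congr 2
    group
  have hs2 : M.ι (SemidirectProduct.inl (c 1 * c 2 : PuncturedSurfaceGroup 0 4)⁻¹ *
        SemidirectProduct.inr (Multiplicative.ofAdd (1 : ℤ))) * M.ι (SemidirectProduct.inl (b 2)) *
        (M.ι (SemidirectProduct.inl (c 1 * c 2 : PuncturedSurfaceGroup 0 4)⁻¹ *
          SemidirectProduct.inr (Multiplicative.ofAdd (1 : ℤ))))⁻¹ =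
      M.ι (SemidirectProduct.inl (b 0 * b 1 * b 2 * (b 0 * b 1)⁻¹)) := by
    rw [hb0, hb1, hb2, u0_conj, M.twist_c_one, hw, inv_inv]
  have h := M.mem_closure_of_commute_pow b hne hprime hs0 hs1 hs2 hg hn hcomm
  rw [hb0, hb1, closure_c_three_c_zero] at h
  rw [vertGpB_map_eq]
  exact h

end Literature.AnabelianGeometry.AbsoluteAnabelian.AbsTopII.TwoTripodNodal.Model

end
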